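import Mathlib
import HarnessLib
import Summits.HubbardSuperconductivity.HubbardSuperconductivity.Theorems.KLProgrammeKLRegimeEngineV8TowerCEDefs
import Summits.HubbardSuperconductivity.HubbardSuperconductivity.Theorems.KLProgrammeKLRegimeEngineScaleZeroLevelZeroFrame

/-!
# Route `KLProgramme` — ENGINE child gen 8 (stmt-HubbardSuperconductivity-20437 `KLRegimeEngineV17F2`), skeleton v2, stub (b) under TABLE B′-DEFERRED:
# THE tower theorem `exists_towerPkg`, TOP LAYER — `TowerNormsStep` from three PART packages (E1 kit part 12; E1 lead r2d-p2 g8)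

`…EngineV8TowerCEDefs` (p561840) relocated stub (b) v2 into ONE theorem, THE tower theorem
`exists_towerPkg : P.WF → R.WF2 → ∃ e, IsTowerPkg e ∧ TowerNormsStep P R (klEngQ8 P R) e.1 e.2` (E1 lineage, B-sized).  Its body, `TowerNormsStep`, is (b) v2's
FOUR conclusion conjuncts at `(klEngGeo8, Q)` for every raise `Q` of `klEngQ8 P R`: (1) `KernelNormsV4 … (K_n) n`, (2) `∀ j ≤ n, KernelNormsLevels … (K_n) j ∧
KernelNormsWt4 (klWtBudget P Q U j) … (K_n) j`, (3) `EngineFirstMoments … klEngGeo8 P Q … (K_n) n`, (4) `TwoLegGridFlowMomentsAt … n`.  These four have THREE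
different producers, and two pieces are already in the tree.  This file is the top layer of the assembly — it fixes what each producer owes, by name, and
discharges the rest:

* conjunct (1) is conjunct (2) at `j = n` (`kernelNormsV4_of_kernelNormsWt4_klWtBudget`, p4's …EngineKernelNormsWt4: `1 ≤ n` so `j = n` is a tower level);
* the `j = 0` summand of (2) is the SCALE-0 rung at the frame `K_n`, raise-generic, v2 binders — `levelZero_norms_frame_of_isRaiseOf_U10L4` (k3c2-p1 p559284;
  `Q` is a raise of `klEngQ7 P R` because `Q₀` is);
* conjunct (3) is the CLASS-#4 flow-scale (E4)ₙ package (`E4FlowAt`, `klE4Pack`, k3c3-p2's …EngineV8DefsG8): `engineFirstMoments_flow_klEngGeo8` from ANY witness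
  `∃ Eu, 0 ≤ Eu.1 ∧ (∀ …, 0 < Eu.2 …) ∧ E4FlowAt Eu.1 Eu.2` (W3's output), at the raise `Q` itself (`E4FlowAt` is `Q`-generic) — so its threshold is read AT `Q`:
  `U ≤ klE4UF klEngGeo8 P R Q cc`.  NOTE FOR …DefsU11 (k3c2-p1): `klEngU₀10`'s entry 5 is `klE4UF klEngGeo8 P R (klEngQ8 P R) cc` — keyed at `klEngQ8`, not at the
  raise; under B′ the (b) closer runs at `Q := klEngQ9 P R`, and the needed `klE4UF klEngGeo8 P R (klEngQ9 P R) cc` rides inside `klTowerU P R (klEngQ9 P R) cc` (the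
  tower threshold built here takes the `min` with it), so the DefsU11 row `⊓ klTowerU P R (klEngQ9 P R) cc` already covers it — no ninth entry is needed.

What is NOT dischargeable from the tree is named as three PART predicates with (b) v2's binders VERBATIM (so each producer proves its part «by name» and the
deferred `klTowerPkg` closes by `exists_towerPkg_of_parts`):

* §1 **`TowerLevelsStep P R Q₀ CE u`** — THE LEVELS PART = the sectorised one-shot blocked tower proper (E1 lineage; memo E1-TOWER-BLOCKED v3 §7–§10, kit
  …EngineTower* parts 1–11b, model-side suppliers k3c2-p3 / p3 / p4 / k3c4-p1): conclusion `∀ j, 1 ≤ j → j ≤ n → KernelNormsLevels … (K_n) j ∧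
  KernelNormsWt4 (klWtBudget P Q U j) … (K_n) j`;
  **`TowerFirstMomentsStep P R Q₀ CE u`** — conjunct (3) as a part (generic; §3 supplies it from the class-#4 package);
  **`TowerGridMomentsStep P R Q₀ CE u`** — THE GRID TWO-LEG MOMENTS PART = conjunct (4), the `m = 2` line of the one-shot tower read on the `4M` grid with the
  pen's (A)-literal budgets (r2d-p1's class-#7 text …TwoLegMomentsExportGrid; `n = 0` base p557865; tower side: part 10 `towerTwoLegIncrement_le` p554711);
  each with `.mono_CE` / `.anti_u`;
* §2 **`towerNormsStep_of_parts`** — for any `Q₀` that is a raise of `klEngQ7 P R` (`klEngQ8`: `isRaiseOf_klEngQ8`; `klEngQ9`: `isRaiseOf_klEngQ9`), the three parts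
  at `(CEℓ,uℓ)`, `(CE₄,u₄)`, `(CEg,ug)` give `TowerNormsStep P R Q₀ (max CEℓ (max CE₄ CEg)) (uℓ ⊓ u₄ ⊓ ug)`; **`exists_towerPkg_of_parts`** — the `∃ e, IsTowerPkg e ∧ …`
  form `klTowerPkg`'s `dif_pos` consumes, from the three `∃`-packages; `towerNormsStep_klTower_of_parts` — straight into the deferred package's row;
* §3 **`towerFirstMomentsStep_of_e4Pack`** — the class-#4 adapter: any `E4FlowAt` witness ⇒ `TowerFirstMomentsStep P R Q₀ CE (fun Q cc => klE4UF klEngGeo8 P R Q cc)`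
  for every well-formed `Q₀` and every `CE`; and **`exists_towerPkg_of_levels_grid_e4`** — THE tower theorem from the levels package, the grid package and W3's witness.

So after this file `exists_towerPkg` = `∃`(levels part) + `∃`(grid part) + W3's `E4FlowAt` witness, nothing else.  Definitions with bodies + compositions of
landed theorems; nothing about the model is asserted; nothing asserts superconductivity.
References: BGM 2006 §2.8 (2.83), Lemma 2.5 (2.98), §3 (3.2)–(3.8) [cite: BenfattoGiulianiMastropietro2006].
-/

noncomputable section

namespace Summit.HubbardSuperconductivity.HubbardSuperconductivity.Theorems.EngineV8

set_option linter.dupNamespace false -- summit = problem name (single-conjunct summit), D-0017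

open Real Finset Literature.MathematicalPhysics.QuantumLattice Literature.Probability.LatticeModels
open Literature.MathematicalPhysics.QuantumLattice.FermiRG
open Summit.HubbardSuperconductivity.HubbardSuperconductivity.Theorems.KLRegimeSplit
open Summit.HubbardSuperconductivity.HubbardSuperconductivity.Theorems.KLProgrammeLegKernels
open Summit.HubbardSuperconductivity.HubbardSuperconductivity.Theorems.DispersionFlow

/-! ## §1 The three part predicates (binders of `TowerNormsStep` VERBATIM) -/

/-- **`TowerLevelsStep P R Q₀ CE u` — THE LEVELS PART of the tower's deliverable**: for every raise `Q` of `Q₀` with `CE ≤ Q.CE`, under (b) v2's binders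
VERBATIM (as in `TowerNormsStep`), at every TOWER LEVEL `1 ≤ j ≤ n` of the flow frame `K_n`:
`KernelNormsLevels L M P Q β U μ (K_n) j ∧ KernelNormsWt4 L M (klWtBudget P Q U j) β U μ (K_n) j` — the levelled sectorised law (BGM Lemma 2.5 (2.98))
and the weighted pinned profile at the E1 budget, i.e. the output of the sectorised one-shot blocked tower at `K_n` (level `0` is the scale-0 rung, not a
tower level). -/
def TowerLevelsStep (P : SplitConsts) (R : RenConsts) (Q₀ : EngConsts) (CE : ℝ) (u : EngConsts → ℝ → ℝ) : Prop :=
  ∀ Q : EngConsts, Q₀.IsRaiseOf Q → CE ≤ Q.CE →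
    ∀ cc : ℝ, 0 < cc → cc ≤ klEngC₃6 P R →
      ∀ μ ∈ klWindowC, ∀ U : ℝ, 0 < U → U ≤ klEngU₀10 P R cc → U ≤ u Q cc →
        ∀ β : ℝ, klBetaMin ≤ β → β ≤ Real.exp (cc / U ^ 2) →
          ∀ (L M : ℕ) [NeZero L] [NeZero M], klEngL₄ P R β U ≤ L → klEngM₃ β U L ≤ M →
            ∀ n : ℕ, 1 ≤ n → n ≤ nScales β + 1 → IsKLRegime U cc (-(n : ℤ)) →
              HistP klPredsV17F2 L M klEngGeo8 P Q R β U μ 0 n →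
                FrameOK R U (nScales β) μ (klFlowFrameU L M β U μ n) →
                  (∀ j ≤ n, LevelsUExportMixedAt L M (klCU2 P R (klEngQ7 P R)) P β U μ j) →
                    ∀ j : ℕ, 1 ≤ j → j ≤ n →
                      KernelNormsLevels L M P Q β U μ (klFlowFrameU L M β U μ n) j ∧
                        KernelNormsWt4 L M (klWtBudget P Q U j) β U μ (klFlowFrameU L M β U μ n) j

/-- **`TowerFirstMomentsStep P R Q₀ CE u` — THE FIRST-MOMENTS PART** (conjunct (3) of `TowerNormsStep`, same binders): `EngineFirstMoments L M klEngGeo8 P Q β U μ (K_n) n`.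
Supplied from the class-#4 package `E4FlowAt` by `towerFirstMomentsStep_of_e4Pack` (§3); kept as a part so that any other producer may serve it. -/
def TowerFirstMomentsStep (P : SplitConsts) (R : RenConsts) (Q₀ : EngConsts) (CE : ℝ) (u : EngConsts → ℝ → ℝ) : Prop :=
  ∀ Q : EngConsts, Q₀.IsRaiseOf Q → CE ≤ Q.CE →
    ∀ cc : ℝ, 0 < cc → cc ≤ klEngC₃6 P R →
      ∀ μ ∈ klWindowC, ∀ U : ℝ, 0 < U → U ≤ klEngU₀10 P R cc → U ≤ u Q cc →
        ∀ β : ℝ, klBetaMin ≤ β → β ≤ Real.exp (cc / U ^ 2) →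
          ∀ (L M : ℕ) [NeZero L] [NeZero M], klEngL₄ P R β U ≤ L → klEngM₃ β U L ≤ M →
            ∀ n : ℕ, 1 ≤ n → n ≤ nScales β + 1 → IsKLRegime U cc (-(n : ℤ)) →
              HistP klPredsV17F2 L M klEngGeo8 P Q R β U μ 0 n →
                FrameOK R U (nScales β) μ (klFlowFrameU L M β U μ n) →
                  (∀ j ≤ n, LevelsUExportMixedAt L M (klCU2 P R (klEngQ7 P R)) P β U μ j) →
                    EngineFirstMoments L M klEngGeo8 P Q β U μ (klFlowFrameU L M β U μ n) n

/-- **`TowerGridMomentsStep P R Q₀ CE u` — THE GRID TWO-LEG MOMENTS PART** (conjunct (4) of `TowerNormsStep`, same binders): the class-#7 export in grid currency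
`TwoLegGridFlowMomentsAt L M Zt Zs β U μ n` at the pen's (A)-literal budgets `Zt = 2^10·e^18·κ₀⁴·klE3Acum R`, `Zs = 2^11·e^18·κ₀⁴·klE3Acum R`
(`κ₀⁴ = √(2·(7+1606732))⁴`) — the `m = 2` line of the one-shot tower at scale `n`, read on the `4M` grid. -/
def TowerGridMomentsStep (P : SplitConsts) (R : RenConsts) (Q₀ : EngConsts) (CE : ℝ) (u : EngConsts → ℝ → ℝ) : Prop :=
  ∀ Q : EngConsts, Q₀.IsRaiseOf Q → CE ≤ Q.CE →
    ∀ cc : ℝ, 0 < cc → cc ≤ klEngC₃6 P R →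
      ∀ μ ∈ klWindowC, ∀ U : ℝ, 0 < U → U ≤ klEngU₀10 P R cc → U ≤ u Q cc →
        ∀ β : ℝ, klBetaMin ≤ β → β ≤ Real.exp (cc / U ^ 2) →
          ∀ (L M : ℕ) [NeZero L] [NeZero M], klEngL₄ P R β U ≤ L → klEngM₃ β U L ≤ M →
            ∀ n : ℕ, 1 ≤ n → n ≤ nScales β + 1 → IsKLRegime U cc (-(n : ℤ)) →
              HistP klPredsV17F2 L M klEngGeo8 P Q R β U μ 0 n →
                FrameOK R U (nScales β) μ (klFlowFrameU L M β U μ n) →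
                  (∀ j ≤ n, LevelsUExportMixedAt L M (klCU2 P R (klEngQ7 P R)) P β U μ j) →
                    TwoLegGridFlowMomentsAt L M ((2 : ℝ) ^ 10 * Real.exp 1 ^ 18 * Real.sqrt (2 * (7 + 1606732)) ^ 4 * klE3Acum R)
                      ((2 : ℝ) ^ 11 * Real.exp 1 ^ 18 * Real.sqrt (2 * (7 + 1606732)) ^ 4 * klE3Acum R) β U μ n

section Rows

variable {P : SplitConsts} {R : RenConsts} {Q₀ : EngConsts} {CE CE' : ℝ} {u u' : EngConsts → ℝ → ℝ}

/-- The levels part is antitone in the demand on `Q.CE`: `CE ≤ CE'` ⇒ fewer raises qualify. -/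
theorem TowerLevelsStep.mono_CE (h : TowerLevelsStep P R Q₀ CE u) (hle : CE ≤ CE') : TowerLevelsStep P R Q₀ CE' u :=
  fun Q hQ hCE => h Q hQ (hle.trans hCE)

/-- The levels part is antitone in the threshold. -/
theorem TowerLevelsStep.anti_u (h : TowerLevelsStep P R Q₀ CE u) (hle : ∀ Q cc, u' Q cc ≤ u Q cc) : TowerLevelsStep P R Q₀ CE u' :=
  fun Q hQ hCE cc hcc hcc6 μ hμ U hU hU10 hUu => h Q hQ hCE cc hcc hcc6 μ hμ U hU hU10 (hUu.trans (hle Q cc))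

/-- The first-moments part is antitone in the demand on `Q.CE`. -/
theorem TowerFirstMomentsStep.mono_CE (h : TowerFirstMomentsStep P R Q₀ CE u) (hle : CE ≤ CE') : TowerFirstMomentsStep P R Q₀ CE' u :=
  fun Q hQ hCE => h Q hQ (hle.trans hCE)

/-- The first-moments part is antitone in the threshold. -/
theorem TowerFirstMomentsStep.anti_u (h : TowerFirstMomentsStep P R Q₀ CE u) (hle : ∀ Q cc, u' Q cc ≤ u Q cc) :
    TowerFirstMomentsStep P R Q₀ CE u' :=
  fun Q hQ hCE cc hcc hcc6 μ hμ U hU hU10 hUu => h Q hQ hCE cc hcc hcc6 μ hμ U hU hU10 (hUu.trans (hle Q cc))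

/-- The grid-moments part is antitone in the demand on `Q.CE`. -/
theorem TowerGridMomentsStep.mono_CE (h : TowerGridMomentsStep P R Q₀ CE u) (hle : CE ≤ CE') : TowerGridMomentsStep P R Q₀ CE' u :=
  fun Q hQ hCE => h Q hQ (hle.trans hCE)

/-- The grid-moments part is antitone in the threshold. -/
theorem TowerGridMomentsStep.anti_u (h : TowerGridMomentsStep P R Q₀ CE u) (hle : ∀ Q cc, u' Q cc ≤ u Q cc) :
    TowerGridMomentsStep P R Q₀ CE u' :=
  fun Q hQ hCE cc hcc hcc6 μ hμ U hU hU10 hUu => h Q hQ hCE cc hcc hcc6 μ hμ U hU hU10 (hUu.trans (hle Q cc))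

/-- Conversely the full deliverable contains the levels part (levels `1 ≤ j ≤ n` of conjunct (2)). -/
theorem TowerNormsStep.levels (h : TowerNormsStep P R Q₀ CE u) : TowerLevelsStep P R Q₀ CE u :=
  fun Q hQ hCE cc hcc hcc6 μ hμ U hU hU10 hUu β hβ hβc L M _ _ hL hM n hn1 hn hreg hhist hfr hlevU j _ hj =>
    (h Q hQ hCE cc hcc hcc6 μ hμ U hU hU10 hUu β hβ hβc L M hL hM n hn1 hn hreg hhist hfr hlevU).2.1 j hj

/-- … the first-moments part (conjunct (3)) … -/
theorem TowerNormsStep.firstMoments (h : TowerNormsStep P R Q₀ CE u) : TowerFirstMomentsStep P R Q₀ CE u :=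
  fun Q hQ hCE cc hcc hcc6 μ hμ U hU hU10 hUu β hβ hβc L M _ _ hL hM n hn1 hn hreg hhist hfr hlevU =>
    (h Q hQ hCE cc hcc hcc6 μ hμ U hU hU10 hUu β hβ hβc L M hL hM n hn1 hn hreg hhist hfr hlevU).2.2.1

/-- … and the grid-moments part (conjunct (4)). -/
theorem TowerNormsStep.gridMoments (h : TowerNormsStep P R Q₀ CE u) : TowerGridMomentsStep P R Q₀ CE u :=
  fun Q hQ hCE cc hcc hcc6 μ hμ U hU hU10 hUu β hβ hβc L M _ _ hL hM n hn1 hn hreg hhist hfr hlevU =>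
    (h Q hQ hCE cc hcc hcc6 μ hμ U hU hU10 hUu β hβ hβc L M hL hM n hn1 hn hreg hhist hfr hlevU).2.2.2

end Rows

/-! ## §2 The assembly: `TowerNormsStep` from the three parts -/

section Assembly

variable {P : SplitConsts} {R : RenConsts} {Q₀ : EngConsts}

/-- **THE TOP LAYER OF THE TOWER THEOREM.**  For any key package `Q₀` that is a raise of `klEngQ7 P R` (`klEngQ8 P R`, `klEngQ9 P R`), the three parts at
`(CEℓ, uℓ)`, `(CE₄, u₄)`, `(CEg, ug)` give the full deliverable `TowerNormsStep P R Q₀ (max CEℓ (max CE₄ CEg)) (fun Q cc => min (uℓ Q cc) (min (u₄ Q cc) (ug Q cc)))`: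
conjunct (1) = conjunct (2) at `j = n` (`kernelNormsV4_of_kernelNormsWt4_klWtBudget`); level `0` of conjunct (2) = the scale-0 rung at the frame `K_n`
(`levelZero_norms_frame_of_isRaiseOf_U10L4`); levels `1 ≤ j ≤ n`, conjuncts (3), (4) = the parts. -/
theorem towerNormsStep_of_parts {CEℓ CE₄ CEg : ℝ} {uℓ u₄ ug : EngConsts → ℝ → ℝ} (hP : P.WF) (hR : R.WF2) (hQ₀ : (klEngQ7 P R).IsRaiseOf Q₀)
    (hℓ : TowerLevelsStep P R Q₀ CEℓ uℓ) (h₄ : TowerFirstMomentsStep P R Q₀ CE₄ u₄) (hg : TowerGridMomentsStep P R Q₀ CEg ug) :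
    TowerNormsStep P R Q₀ (max CEℓ (max CE₄ CEg)) (fun Q cc => min (uℓ Q cc) (min (u₄ Q cc) (ug Q cc))) := by
  intro Q hQ hCE cc hcc hcc6 μ hμ U hU hU10 hUu β hβ hβc L M _ _ hL hM n hn1 hn hreg hhist hfr hlevU
  have hCEℓ : CEℓ ≤ Q.CE := (le_max_left _ _).trans hCE
  have hCE₄ : CE₄ ≤ Q.CE := ((le_max_left _ _).trans (le_max_right _ _)).trans hCE
  have hCEg : CEg ≤ Q.CE := ((le_max_right _ _).trans (le_max_right _ _)).trans hCE
  have hUℓ : U ≤ uℓ Q cc := hUu.trans (min_le_left _ _)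
  have hU₄ : U ≤ u₄ Q cc := hUu.trans ((min_le_right _ _).trans (min_le_left _ _))
  have hUg : U ≤ ug Q cc := hUu.trans ((min_le_right _ _).trans (min_le_right _ _))
  have hβ0 : 0 ≤ β := le_trans (by norm_num [klBetaMin]) hβ
  -- level 0: the scale-0 rung at the frame `K_n`, along the raise `klEngQ7 → Q₀ → Q`
  have h0 := levelZero_norms_frame_of_isRaiseOf_U10L4 P R Q (hQ₀.trans hQ) cc hP hR hcc hcc6 μ hμ U hU hU10 β hβ hβc
    (klFlowFrameU L M β U μ n) hfr L M hL hM
  have hlev : ∀ j ≤ n, KernelNormsLevels L M P Q β U μ (klFlowFrameU L M β U μ n) j ∧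
      KernelNormsWt4 L M (klWtBudget P Q U j) β U μ (klFlowFrameU L M β U μ n) j := by
    intro j hj
    rcases Nat.eq_zero_or_pos j with rfl | hj1
    · exact ⟨h0.2.1, h0.2.2⟩
    · exact hℓ Q hQ hCEℓ cc hcc hcc6 μ hμ U hU hU10 hUℓ β hβ hβc L M hL hM n hn1 hn hreg hhist hfr hlevU j hj1 hj
  refine ⟨kernelNormsV4_of_kernelNormsWt4_klWtBudget hβ0 (hlev n le_rfl).2, hlev, ?_, ?_⟩
  · exact h₄ Q hQ hCE₄ cc hcc hcc6 μ hμ U hU hU10 hU₄ β hβ hβc L M hL hM n hn1 hn hreg hhist hfr hlevU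
  · exact hg Q hQ hCEg cc hcc hcc6 μ hμ U hU hU10 hUg β hβ hβc L M hL hM n hn1 hn hreg hhist hfr hlevU

/-- **`∃`-form**: admissible packages for the three parts give an admissible package for the whole deliverable — the hypothesis of
`towerNormsStep_klTower_of_exists` (…TowerCEDefs) at `Q₀ := klEngQ8 P R`. -/
theorem exists_towerPkg_of_parts (hP : P.WF) (hR : R.WF2) (hQ₀ : (klEngQ7 P R).IsRaiseOf Q₀)
    (hℓ : ∃ e : ℝ × (EngConsts → ℝ → ℝ), IsTowerPkg e ∧ TowerLevelsStep P R Q₀ e.1 e.2)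
    (h₄ : ∃ e : ℝ × (EngConsts → ℝ → ℝ), IsTowerPkg e ∧ TowerFirstMomentsStep P R Q₀ e.1 e.2)
    (hg : ∃ e : ℝ × (EngConsts → ℝ → ℝ), IsTowerPkg e ∧ TowerGridMomentsStep P R Q₀ e.1 e.2) :
    ∃ e : ℝ × (EngConsts → ℝ → ℝ), IsTowerPkg e ∧ TowerNormsStep P R Q₀ e.1 e.2 := by
  obtain ⟨⟨CEℓ, uℓ⟩, ⟨hℓ0, hℓu⟩, hℓ⟩ := hℓ
  obtain ⟨⟨CE₄, u₄⟩, ⟨h₄0, h₄u⟩, h₄⟩ := h₄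
  obtain ⟨⟨CEg, ug⟩, ⟨_, hgu⟩, hg⟩ := hg
  exact ⟨(max CEℓ (max CE₄ CEg), fun Q cc => min (uℓ Q cc) (min (u₄ Q cc) (ug Q cc))),
    ⟨le_max_of_le_left hℓ0, fun Q cc => lt_min (hℓu Q cc) (lt_min (h₄u Q cc) (hgu Q cc))⟩,
    towerNormsStep_of_parts hP hR hQ₀ hℓ h₄ hg⟩

/-- **Straight into the deferred package's row** (table B′): the three part packages at `klEngQ8 P R` ⇒
`TowerNormsStep P R (klEngQ8 P R) (klTowerCE P R) (klTowerU P R)`. -/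
theorem towerNormsStep_klTower_of_parts (hP : P.WF) (hR : R.WF2)
    (hℓ : ∃ e : ℝ × (EngConsts → ℝ → ℝ), IsTowerPkg e ∧ TowerLevelsStep P R (klEngQ8 P R) e.1 e.2)
    (h₄ : ∃ e : ℝ × (EngConsts → ℝ → ℝ), IsTowerPkg e ∧ TowerFirstMomentsStep P R (klEngQ8 P R) e.1 e.2)
    (hg : ∃ e : ℝ × (EngConsts → ℝ → ℝ), IsTowerPkg e ∧ TowerGridMomentsStep P R (klEngQ8 P R) e.1 e.2) :
    TowerNormsStep P R (klEngQ8 P R) (klTowerCE P R) (klTowerU P R) :=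
  towerNormsStep_klTower_of_exists (exists_towerPkg_of_parts hP hR (isRaiseOf_klEngQ8 P R) hℓ h₄ hg)

end Assembly

/-! ## §3 The class-#4 adapter and THE tower theorem modulo the levels part, the grid part and W3's witness -/

section ClassFour

variable {P : SplitConsts} {R : RenConsts} {Q₀ : EngConsts}

/-- **The first-moments part from the class-#4 package.**  Any (E4)ₙ witness `E4FlowAt E u'` (`0 ≤ E`, `u' > 0`; W3's output) gives
`TowerFirstMomentsStep P R Q₀ CE (fun Q cc => klE4UF klEngGeo8 P R Q cc)` for every `Q₀` that is a raise of `klEngQ7 P R` and EVERY `CE`: the witness is consumed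
through the package `(klE4TF, klE4UF)` at the raise `Q` itself (`engineFirstMoments_flow_klEngGeo8`; `Q.WF` from `klEngQ7_wf` along the raise; `klEngL₃ ≤ klEngL₄`). -/
theorem towerFirstMomentsStep_of_e4Pack (hP : P.WF) (hR : R.WF2) (hQ₀ : (klEngQ7 P R).IsRaiseOf Q₀)
    (hE : ∃ Eu : ℝ × (GeoConsts → SplitConsts → RenConsts → EngConsts → ℝ → ℝ),
      0 ≤ Eu.1 ∧ (∀ G P R Q cc, 0 < Eu.2 G P R Q cc) ∧ E4FlowAt Eu.1 Eu.2) (CE : ℝ) :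
    TowerFirstMomentsStep P R Q₀ CE (fun Q cc => klE4UF klEngGeo8 P R Q cc) := by
  obtain ⟨⟨E, u'⟩, hE0, hu', hE⟩ := hE
  intro Q hQ _ cc hcc hcc6 μ hμ U hU _ hUu β hβ hβc L M _ _ hL hM n hn1 hn hreg hhist hfr _
  exact engineFirstMoments_flow_klEngGeo8 hE0 hu' hE P R Q cc hP hR ((hQ₀.trans hQ).wf (klEngQ7_wf P R)) hcc hcc6 μ hμ U hU hUu β hβ
    hβc L M (klEngL₃_le_of_klEngL₄_le hL) hM n hn1 hn hreg hhist hfr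

/-- The class-#4 package as an admissible `∃`-package for the first-moments part (constant `0`, threshold `klE4UF klEngGeo8 P R`). -/
theorem exists_towerFirstMomentsPkg_of_e4Pack (hP : P.WF) (hR : R.WF2) (hQ₀ : (klEngQ7 P R).IsRaiseOf Q₀)
    (hE : ∃ Eu : ℝ × (GeoConsts → SplitConsts → RenConsts → EngConsts → ℝ → ℝ),
      0 ≤ Eu.1 ∧ (∀ G P R Q cc, 0 < Eu.2 G P R Q cc) ∧ E4FlowAt Eu.1 Eu.2) :
    ∃ e : ℝ × (EngConsts → ℝ → ℝ), IsTowerPkg e ∧ TowerFirstMomentsStep P R Q₀ e.1 e.2 :=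
  ⟨(0, fun Q cc => klE4UF klEngGeo8 P R Q cc), ⟨le_rfl, fun Q cc => klE4UF_pos klEngGeo8 P R Q cc⟩,
    towerFirstMomentsStep_of_e4Pack hP hR hQ₀ hE 0⟩

/-- **THE TOWER THEOREM MODULO ITS TWO E1 PARTS AND W3's WITNESS** (table B′, `Q₀ := klEngQ8 P R`): an admissible levels package, an admissible grid-moments
package and any `E4FlowAt` witness give `∃ e, IsTowerPkg e ∧ TowerNormsStep P R (klEngQ8 P R) e.1 e.2` — literally the `∃` of `exists_towerPkg`. -/
theorem exists_towerPkg_of_levels_grid_e4 (hP : P.WF) (hR : R.WF2)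
    (hℓ : ∃ e : ℝ × (EngConsts → ℝ → ℝ), IsTowerPkg e ∧ TowerLevelsStep P R (klEngQ8 P R) e.1 e.2)
    (hg : ∃ e : ℝ × (EngConsts → ℝ → ℝ), IsTowerPkg e ∧ TowerGridMomentsStep P R (klEngQ8 P R) e.1 e.2)
    (hE : ∃ Eu : ℝ × (GeoConsts → SplitConsts → RenConsts → EngConsts → ℝ → ℝ),
      0 ≤ Eu.1 ∧ (∀ G P R Q cc, 0 < Eu.2 G P R Q cc) ∧ E4FlowAt Eu.1 Eu.2) :
    ∃ e : ℝ × (EngConsts → ℝ → ℝ), IsTowerPkg e ∧ TowerNormsStep P R (klEngQ8 P R) e.1 e.2 :=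
  exists_towerPkg_of_parts hP hR (isRaiseOf_klEngQ8 P R) hℓ (exists_towerFirstMomentsPkg_of_e4Pack hP hR (isRaiseOf_klEngQ8 P R) hE) hg

/-- … and hence the deferred package's row `TowerNormsStep P R (klEngQ8 P R) (klTowerCE P R) (klTowerU P R)` (what the (b) v2 closer reads). -/
theorem towerNormsStep_klTower_of_levels_grid_e4 (hP : P.WF) (hR : R.WF2)
    (hℓ : ∃ e : ℝ × (EngConsts → ℝ → ℝ), IsTowerPkg e ∧ TowerLevelsStep P R (klEngQ8 P R) e.1 e.2)
    (hg : ∃ e : ℝ × (EngConsts → ℝ → ℝ), IsTowerPkg e ∧ TowerGridMomentsStep P R (klEngQ8 P R) e.1 e.2)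
    (hE : ∃ Eu : ℝ × (GeoConsts → SplitConsts → RenConsts → EngConsts → ℝ → ℝ),
      0 ≤ Eu.1 ∧ (∀ G P R Q cc, 0 < Eu.2 G P R Q cc) ∧ E4FlowAt Eu.1 Eu.2) :
    TowerNormsStep P R (klEngQ8 P R) (klTowerCE P R) (klTowerU P R) :=
  towerNormsStep_klTower_of_exists (exists_towerPkg_of_levels_grid_e4 hP hR hℓ hg hE)

end ClassFour

end Summit.HubbardSuperconductivity.HubbardSuperconductivity.Theorems.EngineV8

end
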